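import Summits.QuantumFields.YangMills.Theorems.LuscherReductionTwistedTraceScalingOnionRefined
import HarnessLib

/-!
# The glue re-run on the REFINED onion: COARSE-UPPER(L) from VALLEY GAIN + INNER NO-INTRUDER with the valley at any action scale `η = β^{−q}`, `q < 2/3`
# (lane A of S-BASE, crux `TwistedTraceScaling` stmt-QuantumFields-20203 / KT-door 3b′; design note `pub/ym-fleet/ym-luscher-20007-p1/COARSE-DESIGN.md` §15)

`boUpper_of_valley_inner` (`…CoarseUpperGlue`) re-proved VERBATIM with the refined onion `qform_le_three_regions_lat₂` / `onionErr₂` / `ScalesAdmissible₂`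
(`…OnionRefined`) in place of the old one: ★★★ `boUpper_of_valley_inner₂ : ScalesAdmissible₂ L δ η → ValleyGainAt L δ η → InnerNoIntruderAt L δ → BOUpperAt L`,
hence `coarseNoIntruderAt_of_valley_inner₂` (conclusion = VERBATIM the body of KTR's `CoarseNoIntruderAt L`), ★★★ `coarseNoIntruderAt_of_valley_oneOrbit_pow₃` and
`coarseNoIntruderAt_of_kernelRow_pow₃`: COARSE-UPPER(L) ⇐ `ValleyKernelRowBoundAt L (β^{−p}) (β^{−q})` (`…ValleySchurDoor`) + `InnerNoIntruderOneOrbitAt L (β^{−p})`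
for ANY `0 < p < 1/3` and `q < 2/3` — so the VALLEY may be placed at `q ∈ (1/2, 2/3)` where `βS(U)² → 0` and `βS(U)ρ → 0` hold uniformly on it (the precision
regime of the covariant harmonic step, `…StepKernelValley` / lane B `…StepKernelChart`).
HONEST FRAMING: a reduction; V(L) and I(L) remain OPEN fixed-lattice semiclassics; femto rung R2b1 of the CONDITIONAL reduction route; not a gap, not Clay.
-/

set_option autoImplicit false

noncomputable section

open MeasureTheory Filter Topology Real
open scoped BigOperators
open Literature.MathematicalPhysics.QuantumFieldTheory
open Literature.MathematicalPhysics.QuantumLattice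

namespace Summit.QuantumFields.YangMills.Theorems.FemtoTransferGap

variable {L : ℕ} [NeZero L]

/-! ## §4 The glue re-run on the refined onion -/

/-- ★★★ **`BO_up(L)` from `V(L)` and `I(L)` at any pair of scales admissible for the REFINED onion** (proof = `boUpper_of_valley_inner` of `…CoarseUpperGlue`
verbatim, with `qform_le_three_regions_lat₂` / `onionErr₂` in place of the old onion). [cite: Luscher1983, §3] [cite: SimonB1983DiscreteSpectrum, §3] -/
theorem boUpper_of_valley_inner₂ {δ η : ℝ → ℝ} (hS : ScalesAdmissible₂ L δ η) (hV : ValleyGainAt L δ η) (hI : InnerNoIntruderAt L δ) :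
    BOUpperAt L := by
  intro k ε hε
  obtain ⟨hδ, hη, hErr⟩ := hS
  obtain ⟨C, B0, hONE⟩ := oneSiteLevels_proof k
  obtain ⟨βV, hV'⟩ := hV (levelGap k + 1)
  obtain ⟨βI, hI'⟩ := hI k (ε / 2) (half_pos hε)
  have hκ0 : 0 < min (ε / 8) (1 / 8) := lt_min (by positivity) (by norm_num)
  have hκε : min (ε / 8) (1 / 8) ≤ ε / 4 := (min_le_left _ _).trans (by linarith)
  have hκ4 : min (ε / 8) (1 / 8) ≤ 1 / 4 := (min_le_right _ _).trans (by norm_num)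
  obtain ⟨βE, hE⟩ := hErr (min (ε / 8) (1 / 8)) hκ0
  have hτ0 : 0 < 1 / (2 * (|levelGap k| + |C| + 2)) := by positivity
  refine ⟨max (max 1 B0) (max (max βV βI) (max βE (2 / (1 / (2 * (|levelGap k| + |C| + 2))) ^ 3))), fun β hβ => ?_⟩
  have hβ1 : 1 ≤ β := ((le_max_left _ _).trans (le_max_left _ _)).trans hβ
  have hβ0 : 0 < β := by linarith
  have hβB0 : B0 ≤ β := ((le_max_right _ _).trans (le_max_left _ _)).trans hβ
  have hβV : βV ≤ β := (((le_max_left _ _).trans (le_max_left _ _)).trans (le_max_right _ _)).trans hβ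
  have hβI : βI ≤ β := (((le_max_right _ _).trans (le_max_left _ _)).trans (le_max_right _ _)).trans hβ
  have hβE : βE ≤ β := (((le_max_left _ _).trans (le_max_right _ _)).trans (le_max_right _ _)).trans hβ
  have hβτ : 2 / (1 / (2 * (|levelGap k| + |C| + 2))) ^ 3 ≤ β :=
    (((le_max_right _ _).trans (le_max_right _ _)).trans (le_max_right _ _)).trans hβ
  -- the natural coupling and the one-site levels
  have hL1 : (1 : ℝ) ≤ (L : ℝ) ^ 3 := one_le_pow₀ (by exact_mod_cast NeZero.one_le)
  have hB'β : β ≤ (L : ℝ) ^ 3 * β := by nlinarith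
  have hB'0 : 0 < (L : ℝ) ^ 3 * β := lt_of_lt_of_le hβ0 hB'β
  obtain ⟨hμ0, -, hμk⟩ := hONE ((L : ℝ) ^ 3 * β) (hβB0.trans hB'β)
  have hlam0 : 0 < bareLambda ((L : ℝ) ^ 3 * β) := bareLambda_pos' hB'0
  have hlamτ : bareLambda ((L : ℝ) ^ 3 * β) ≤ 1 / (2 * (|levelGap k| + |C| + 2)) := bareLambda_cube_le (L := L) hτ0 hβτ
  have hΛ0 : 0 < levelValue su2Rep L β 0 := levelValue_su2Rep_pos hβ0 0
  obtain ⟨h1, h2, hy⟩ := smallness_of_le hlam0.le hlamτ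
  -- ONE's lower bound with `|C|`, and `μ_k ≥ μ₀/2`
  have hμk' : Real.exp (-(levelGap k * bareLambda ((L : ℝ) ^ 3 * β) + |C| * bareLambda ((L : ℝ) ^ 3 * β) ^ 2)) *
      levelValue su2Rep 1 ((L : ℝ) ^ 3 * β) 0 ≤ levelValue su2Rep 1 ((L : ℝ) ^ 3 * β) k := by
    refine le_trans (mul_le_mul_of_nonneg_right (Real.exp_le_exp.2 ?_) hμ0.le) hμk
    have := mul_le_mul_of_nonneg_right (le_abs_self C) (sq_nonneg (bareLambda ((L : ℝ) ^ 3 * β)))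
    linarith
  have hμk2 := half_le_of_exp_lower hy hμ0.le hμk'
  -- the error budget through the floor
  have herr : onionErr₂ L β (δ β) (η β) * latCE L β ≤
      min (ε / 8) (1 / 8) * bareLambda ((L : ℝ) ^ 3 * β) * levelValue su2Rep L β 0 := by
    have h := mul_le_mul_of_nonneg_right (hE β hβE) (latCE_pos (L := L) hβ0.le).le
    refine h.trans ?_
    rw [mul_assoc (min (ε / 8) (1 / 8) * bareLambda ((L : ℝ) ^ 3 * β))]
    exact mul_le_mul_of_nonneg_left (levelValue_zero_ge_uniform hβ1) (by positivity)
  -- endgame targets (a), (b)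
  have hA := endgame_a hε.le hlam0.le hμ0.le hμk2 hκε
  have hB := endgame_b hε.le hlam0.le h1 h2 hμ0.le hμk' hκ4
  -- suppose BO_up fails at `β`
  by_contra H
  push Not at H
  -- the exact eigenfamily and its inner pieces
  obtain ⟨e, he, hon, heig⟩ := exists_isPhys_eigenfamily_of_pos (L := L) hβ0 k
  obtain ⟨F, hFdef⟩ : ∃ F : Fin (k + 1) → GaugeConfig 3 L SU2 → ℝ, F = fun i U => Real.cos (innerPhase (δ β) U) * e i U := ⟨_, rfl⟩
  have hFphys : ∀ i, IsPhys (F i) := fun i => by rw [hFdef]; exact isPhys_inner (δ β) (he i)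
  have hFsupp : ∀ i U, F i U ≠ 0 → ∃ z : Fin 3 → Bool, orbitDist (TT.twist3 z U) < δ β := fun i U h => by
    rw [hFdef] at h
    exact exists_orbitDist_lt_of_cos_ne_zero (hδ β) (left_ne_zero_of_mul h)
  -- KEY ESTIMATE for every coefficient vector
  have key : ∀ a : Fin (k + 1) → ℝ,
      0 ≤ l2 (fun U => ∑ i, a i * F i U) (fun U => ∑ i, a i * F i U) ∧
      l2 (fun U => ∑ i, a i * F i U) (fun U => ∑ i, a i * F i U) ≤ ∑ i, a i ^ 2 ∧
      levelValue su2Rep L β k * levelValue su2Rep 1 ((L : ℝ) ^ 3 * β) 0 * ∑ i, a i ^ 2 ≤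
        qform su2Rep β (fun U => ∑ i, a i * F i U) (fun U => ∑ i, a i * F i U) * levelValue su2Rep 1 ((L : ℝ) ^ 3 * β) 0
          + Real.exp (-((levelGap k + 1) * bareLambda ((L : ℝ) ^ 3 * β))) * levelValue su2Rep L β 0 *
              levelValue su2Rep 1 ((L : ℝ) ^ 3 * β) 0 * (∑ i, a i ^ 2 - l2 (fun U => ∑ i, a i * F i U) (fun U => ∑ i, a i * F i U))
          + min (ε / 8) (1 / 8) * bareLambda ((L : ℝ) ^ 3 * β) * levelValue su2Rep L β 0 * levelValue su2Rep 1 ((L : ℝ) ^ 3 * β) 0 *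
              ∑ i, a i ^ 2 := by
    intro a
    have hψ : IsPhys (fun U => ∑ i, a i * e i U) := isPhys_sum_mul_lat Finset.univ e he a
    obtain ⟨hn, hq⟩ := forms_of_eigenfamily_lat he hon heig a
    -- the inner piece of `ψ` is the combination of the `F i`
    have hin : (fun U => Real.cos (innerPhase (δ β) U) * ∑ i, a i * e i U) = fun U => ∑ i, a i * F i U := by
      rw [hFdef]; exact cut_sum_mul _ a e
    -- onion
    have honion := qform_le_three_regions_lat₂ hβ0 (hδ β) (hη β) hψ
    rw [hin, hn] at honion
    -- valley
    have hψoutP : IsPhys (fun U => Real.sin (innerPhase (δ β) U) * ∑ i, a i * e i U) := isPhys_outer (δ β) hψ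
    have hVal := hV' β hβV _ (isPhys_valley (η β) hψoutP) fun U hU =>
      valley_support (hδ β) (hη β) (fun U => ∑ i, a i * e i U) hU
    have hvalout := l2_mul_le hψoutP (J := fun U => Real.cos (actionPhase (η β) U)) fun U => Real.abs_cos_le_one _
    have hsplit := l2_cos_add_l2_sin (measurable_innerPhase (δ β)) hψ
    rw [hin, hn] at hsplit
    -- floor of the span
    have hfloorK : levelValue su2Rep L β k * ∑ i, a i ^ 2 ≤ qform su2Rep β (fun U => ∑ i, a i * e i U) (fun U => ∑ i, a i * e i U) := by
      rw [hq, Finset.mul_sum]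
      refine Finset.sum_le_sum fun i _ => mul_le_mul_of_nonneg_right ?_ (sq_nonneg _)
      exact levelValue_le_of_le hβ0 (Nat.le_of_lt_succ i.2)
    have hnin0 : 0 ≤ l2 (fun U => ∑ i, a i * F i U) (fun U => ∑ i, a i * F i U) := l2_self_nonneg_lat _
    have hout0 := l2_self_nonneg_lat (fun U => Real.sin (innerPhase (δ β) U) * ∑ i, a i * e i U)
    refine ⟨hnin0, by linarith, ?_⟩
    have hE0 : 0 ≤ Real.exp (-((levelGap k + 1) * bareLambda ((L : ℝ) ^ 3 * β))) * levelValue su2Rep L β 0 := by positivity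
    have hout_eq : l2 (fun U => Real.sin (innerPhase (δ β) U) * ∑ i, a i * e i U) (fun U => Real.sin (innerPhase (δ β) U) * ∑ i, a i * e i U)
        = ∑ i, a i ^ 2 - l2 (fun U => ∑ i, a i * F i U) (fun U => ∑ i, a i * F i U) := by linarith [hsplit]
    have h3 := hVal.trans (mul_le_mul_of_nonneg_left (hvalout.trans hout_eq.le) hE0)
    have h4 := mul_le_mul_of_nonneg_right herr (Finset.sum_nonneg fun i (_ : i ∈ Finset.univ) => sq_nonneg (a i))
    have h5 : levelValue su2Rep L β k * ∑ i, a i ^ 2 ≤ qform su2Rep β (fun U => ∑ i, a i * F i U) (fun U => ∑ i, a i * F i U)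
        + Real.exp (-((levelGap k + 1) * bareLambda ((L : ℝ) ^ 3 * β))) * levelValue su2Rep L β 0 *
            (∑ i, a i ^ 2 - l2 (fun U => ∑ i, a i * F i U) (fun U => ∑ i, a i * F i U))
        + min (ε / 8) (1 / 8) * bareLambda ((L : ℝ) ^ 3 * β) * levelValue su2Rep L β 0 * ∑ i, a i ^ 2 := by
      linarith [honion, h3, h4, hfloorK]
    have h6 := mul_le_mul_of_nonneg_right h5 hμ0.le
    linarith [h6]
  -- nondegeneracy of the inner Gram matrix
  have hGram : ∀ a : Fin (k + 1) → ℝ, a ≠ 0 → 0 < l2 (fun U => ∑ i, a i * F i U) (fun U => ∑ i, a i * F i U) := by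
    intro a ha
    obtain ⟨hnin0, -, hkey⟩ := key a
    have hn : 0 < ∑ i, a i ^ 2 := sum_sq_pos_of_ne_zero ha
    rcases hnin0.lt_or_eq with hpos | hzero
    · exact hpos
    · exfalso
      have hq0 : qform su2Rep β (fun U => ∑ i, a i * F i U) (fun U => ∑ i, a i * F i U) ≤ 0 := by
        have h := qform_le_latCE_mul_l2 hβ0.le (isPhys_sum_mul_lat Finset.univ F hFphys a)
        rw [← hzero, mul_zero] at h; exact h
      rw [← hzero] at hkey
      exact absurd (gram_endgame hn hΛ0 hμ0.le hq0 hkey hB) (not_le.mpr H)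
  -- INNER NO-INTRUDER supplies a good combination; the endgame contradicts `H`
  obtain ⟨a, ha, hIa⟩ := hI' β hβI F hFphys hFsupp hGram
  obtain ⟨hnin0, hnin1, hkey⟩ := key a
  exact absurd (bo_endgame (sum_sq_pos_of_ne_zero ha) hnin0 hnin1 hΛ0 hkey hIa hA hB) (not_le.mpr H)


/-- ★★★ **COARSE-UPPER(L) from VALLEY GAIN + INNER NO-INTRUDER at refined-admissible scales** (conclusion = VERBATIM the body of KTR's `CoarseNoIntruderAt L`).
[cite: Luscher1983, §3] [cite: LuscherMunster1984, §2] -/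
theorem coarseNoIntruderAt_of_valley_inner₂ {δ η : ℝ → ℝ} (hS : ScalesAdmissible₂ L δ η) (hV : ValleyGainAt L δ η)
    (hI : InnerNoIntruderAt L δ) :
    ∀ k : ℕ, ∀ d : ℝ, d < levelGap k → ∃ lam0 : ℝ, 0 < lam0 ∧ ∀ lam : ℝ, 0 < lam → lam ≤ lam0 →
      ∀ β : ℝ, InFemtoWindow lam β L →
        levelValue su2Rep L β k ≤ Real.exp (-(d * luscherLambda β L) / L) * levelValue su2Rep L β 0 :=
  BOHandover.coarseNoIntruderAt_of_boUpper L (boUpper_of_valley_inner₂ hS hV hI) oneSiteLevels_proof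

/-- ★★★ **COARSE-UPPER(L) at polynomial scales `(δ, η) = (β^{−p}, β^{−q})`, `0 < p < 1/3`, `q < 2/3`**, from `ValleyGainAt` and the one-orbit INNER NO-INTRUDER —
the VALLEY may now be placed at `q ∈ (1/2, 2/3)`, where `βS(U)² → 0` uniformly on it. [cite: Luscher1983, §3] [cite: LuscherMunster1984, §2] -/
theorem coarseNoIntruderAt_of_valley_oneOrbit_pow₃ {p q : ℝ} (hp0 : 0 < p) (hp : p < 1 / 3) (hq : q < 2 / 3)
    (hV : ValleyGainAt L (powScale p) (powScale q)) (hI : InnerNoIntruderOneOrbitAt L (powScale p)) :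
    ∀ k : ℕ, ∀ d : ℝ, d < levelGap k → ∃ lam0 : ℝ, 0 < lam0 ∧ ∀ lam : ℝ, 0 < lam → lam ≤ lam0 →
      ∀ β : ℝ, InFemtoWindow lam β L →
        levelValue su2Rep L β k ≤ Real.exp (-(d * luscherLambda β L) / L) * levelValue su2Rep L β 0 := by
  have hL : (0 : ℝ) < L := by exact_mod_cast Nat.pos_of_ne_zero (NeZero.ne L)
  exact coarseNoIntruderAt_of_valley_inner₂ (scalesAdmissible₂_powScale hp0 hp hq) hV
    (innerNoIntruderAt_of_oneOrbit (fun β => powScale_pos p β) (powScale_eventually_le hp0 (by positivity)) hI)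

/-- ★★★ **COARSE-UPPER(L) from the covariant VALLEY KERNEL ROW BOUND (`…ValleySchurDoor`) and INNER NO-INTRUDER (one orbit) at `(β^{−p}, β^{−q})`, `0 < p < 1/3`,
`q < 2/3`.** [cite: Luscher1983, §3] [cite: LuscherMunster1984, §2] -/
theorem coarseNoIntruderAt_of_kernelRow_pow₃ {p q : ℝ} (hp0 : 0 < p) (hp : p < 1 / 3) (hq : q < 2 / 3)
    (hV : ValleyKernelRowBoundAt L (powScale p) (powScale q)) (hI : InnerNoIntruderOneOrbitAt L (powScale p)) :
    ∀ k : ℕ, ∀ d : ℝ, d < levelGap k → ∃ lam0 : ℝ, 0 < lam0 ∧ ∀ lam : ℝ, 0 < lam → lam ≤ lam0 →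
      ∀ β : ℝ, InFemtoWindow lam β L →
        levelValue su2Rep L β k ≤ Real.exp (-(d * luscherLambda β L) / L) * levelValue su2Rep L β 0 :=
  coarseNoIntruderAt_of_valley_oneOrbit_pow₃ hp0 hp hq (valleyGainAt_of_kernelRowBound hV) hI


end Summit.QuantumFields.YangMills.Theorems.FemtoTransferGap

end
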